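import Summits.QuantumFields.BalabanUV.T4Continuum.Support.SkeletonPrecompFlux
import Summits.QuantumFields.BalabanUV.T4Continuum.Support.GaugeFieldPerturbation

/-!
# T⁴ programme, node NE3 — the kinematic refinement lemma, leaf R1a (row NE3-S4c), file 7:
# THE COVARIANT FLUX GRADIENT OF THE PRE-COMPENSATED DATUM — `‖∇_T log T(∂p)‖ ≤ (2d − 1)·g + gradRem(d)·a²`, and the
# j-UNIFORM LEVEL FORM the socket `ApproxRefine` consumes

Cell `pub-balaban`, NE3 (node U1b) formalisation swarm, unit `b2b-balaban-t4-ne3-formalise-leaf-01` (LEAF PROVER 01),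
row **S4c** of `t4/formal/NE3/LEAVES.md` (leaf R1a of the OWNER skeleton v1.2; socket NE3-R1 =
`SmoothRefineOfApprox.ApproxRefine`).  For `U` unitary with `SmallField U a` and covariant flux gradients `≤ g`
(`‖covGrad U (flux U) z μ π‖ ≤ g`), and `T = precomp L U = exp(−X₀)·U` (file 4): §1 transport lemmas — every plaquette
word within `a` of `1`; `‖Ad_u Ad_{A′} X′ − Ad_A X‖ ≤ 2‖uA′ − Au′‖·‖X′‖ + ‖Ad_{u′}X′ − X‖` (`norm_transport_le`); the
commutation identities of a bond with the transporters of the shift `D` (`group` in the units) and their defects `a`,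
`3a`, `2a`.  §2 **`norm_covGrad_fluxShift_le`**: `‖Ad_{U(z,μ)} D(z+e_μ) − D(z)‖ ≤ 4·c_X + 12·a·x₀`,
`c_X = ((L−1)/(2L))(d−1)g` (file 5), `x₀ ≥ ‖X₀‖`.  §3 **`norm_covGrad_precomp_le`**:
`‖covGrad T (flux T) z μ π‖ ≤ (2d − 1)·g + gradRem(d)·a²`, `gradRem d = 60(d−1) + 312(d−1)² + 8(d−1)(8d−7)`, under
`(d−1)a ≤ 1/32`, `(8d−7)a ≤ 1/4` (decomposition `∇_T log T(∂p) = [Ad_{e^{−X₀}} − 1]Y + ∇_U log U(∂p) + ∇D + ∇R`, file 6's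
`‖R‖ ≤ 156x₀² + 24x₀a`, `x₀ = (d−1)a`); and **`precomp_level`**: at spacing `η = L^{−j}`, `SmallField U (b·η²)` and
gradients `≤ c·η³` with `(d−1)b ≤ 1/32`, `(8d−7)b ≤ 1/4` give `T` unitary, `SmallField T ((8d−7)b·η²)` and gradients
`≤ ((2d−1)c + gradRem(d)b²)·η³` — constants in `d, b, c` only, j-UNIFORM.  With files 1–6 this closes row S4c's analytic
content (coarse `U` ↦ datum `T` ↦ 2-skeleton filling `fill2 L T` read off `T` exactly); NOT here: cells of dimension
`≥ 3` (S4d), loop-log prediction ∕ mismatch (S4e), the `ApproxRefine` assembly, the glue R0 (owner).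

HONEST FRAMING.  Elementary matrix analysis with explicit constants; no estimate of the series, no minimiser; no
conditional of the cell (`BetaPertH`, (B), (B^μ)) is used or hidden; nothing bears on infinite volume, a mass gap, or
the Clay problem; **NE3 is NOT proved**, `SmoothRefine` ∕ `ApproxRefine` are NOT proved here; no leaf of NE3 is
instantiated on Bałaban's minimisers.  Finite T⁴ rung (B)+1.  ABSOLUTE RULE kept: no printed sentence is a hypothesis of
any declaration; no `sorry`, axioms ⊆ {propext, Classical.choice, Quot.sound}.  PLACEMENT (human rule 2026-08-19): cell
work under `Summits/QuantumFields/BalabanUV/`; imports file 6 and leaf-09's accepted `Support.GaugeFieldPerturbation`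
(`norm_Ad_sub_Ad_le`, `norm_flux_le_of_smallField`) BY NAME; moves nothing.
-/

set_option autoImplicit false

open scoped BigOperators Matrix Matrix.Norms.L2Operator
open NormedSpace Finset

namespace Summit.QuantumFields.BalabanUV.T4Continuum.SkeletonPrecompGrad

open Literature.MathematicalPhysics.QuantumFieldTheory.Balaban1983to89
open B7Prop1Explicit B7Prop2Explicit B7Prop1Local MatrixLog
open T4AveragingDeficitWall hiding Site Plane Plaq Bond
open AveragingDeficitTransport (norm_Ad_of_unitary mem_U1_of_unitary)
open AveragingDeficitNearIdentity (Ad_one Ad_real_smul Ad_add Ad_neg Ad_sum norm_Ad_sub_le)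
open T4AveragingDeficitNonAbelian (Ad_mul Ad_sub)
open GaugeFieldPerturbation (norm_Ad_sub_Ad_le norm_flux_le_of_smallField)
open SkeletonPrecomp SkeletonPrecompTools SkeletonPrecompFlux

noncomputable section

variable {d : ℕ} {n : Type*} [Fintype n] [DecidableEq n]

/-! ## §1 Transport lemmas -/

/-- In a small field EVERY plaquette word (also `κ = ν`, where the holonomy is `1`) is within `a` of `1`. [folklore] -/
theorem norm_plaq_sub_one_le {U : B7Prop1Explicit.Site d → Fin d → (Matrix n n ℂ)ˣ} {a : ℝ} (hs : SmallField U a)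
    (ha0 : 0 ≤ a) (z : B7Prop1Explicit.Site d) (κ ν : Fin d) :
    ‖((hol U z (plaqWord κ ν) : (Matrix n n ℂ)ˣ) : Matrix n n ℂ) - 1‖ ≤ a := by
  by_cases h : κ = ν
  · subst h; rw [hol_plaqWord_self, Units.val_one, sub_self, norm_zero]; exact ha0
  · exact hs z κ ν h

/-- **TRANSPORT**: `Ad_u Ad_{A′} X′ − Ad_A X = [Ad_{uA′} − Ad_{Au′}] X′ + Ad_A (Ad_{u′} X′ − X)`, hence
`‖Ad_u Ad_{A′} X′ − Ad_A X‖ ≤ 2‖uA′ − Au′‖·‖X′‖ + ‖Ad_{u′}X′ − X‖` for unitary units. [folklore] -/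
theorem norm_transport_le [Nonempty n] {u u' A A' : (Matrix n n ℂ)ˣ} (hu : u ∈ unitaryUnits (Matrix n n ℂ))
    (hu' : u' ∈ unitaryUnits (Matrix n n ℂ)) (hA : A ∈ unitaryUnits (Matrix n n ℂ))
    (hA' : A' ∈ unitaryUnits (Matrix n n ℂ)) (X X' : Matrix n n ℂ) :
    ‖Ad u (Ad A' X') - Ad A X‖
      ≤ 2 * ‖((u * A' : (Matrix n n ℂ)ˣ) : Matrix n n ℂ) - ((A * u' : (Matrix n n ℂ)ˣ) : Matrix n n ℂ)‖ * ‖X'‖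
        + ‖Ad u' X' - X‖ := by
  rw [show Ad u (Ad A' X') - Ad A X = (Ad (u * A') X' - Ad (A * u') X') + Ad A (Ad u' X' - X) by
    rw [Ad_mul, Ad_mul, Ad_sub]; abel]
  refine (norm_add_le _ _).trans (add_le_add ?_ ?_)
  · exact norm_Ad_sub_Ad_le ((unitaryUnits _).mul_mem hA hu') ((unitaryUnits _).mul_mem hu hA') X'
  · rw [norm_Ad_of_unitary hA]

section Commute

variable {U : B7Prop1Explicit.Site d → Fin d → (Matrix n n ℂ)ˣ} {a : ℝ}

/-- Commutation of two bonds at a corner: `U(z,μ)U(z+e_μ,κ) = U(∂p_{μκ}(z)) · U(z,κ)U(z+e_κ,μ)`. [folklore] -/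
theorem bond_comm_two (U : B7Prop1Explicit.Site d → Fin d → (Matrix n n ℂ)ˣ) (z : B7Prop1Explicit.Site d) (μ κ : Fin d) :
    U z μ * U (z + e μ) κ = hol U z (plaqWord μ κ) * (U z κ * U (z + e κ) μ) := by
  rw [hol_plaqWord_eq]; group

/-- Its norm defect: `‖U(z,μ)U(z+e_μ,κ) − U(z,κ)U(z+e_κ,μ)‖ ≤ a`. [folklore] -/
theorem norm_bond_comm_two [Nonempty n] (hU : IsUnitaryCfg U) (hs : SmallField U a) (ha0 : 0 ≤ a)
    (z : B7Prop1Explicit.Site d) (μ κ : Fin d) :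
    ‖((U z μ * U (z + e μ) κ : (Matrix n n ℂ)ˣ) : Matrix n n ℂ) - ((U z κ * U (z + e κ) μ : (Matrix n n ℂ)ˣ) : Matrix n n ℂ)‖
      ≤ a := by
  rw [bond_comm_two U z μ κ, Units.val_mul]
  set M : Matrix n n ℂ := ((U z κ * U (z + e κ) μ : (Matrix n n ℂ)ˣ) : Matrix n n ℂ)
  have hM : ‖M‖ ≤ 1 := (mem_U1_of_unitary ((unitaryUnits _).mul_mem (hU _ _) (hU _ _))).1
  rw [show ((hol U z (plaqWord μ κ) : (Matrix n n ℂ)ˣ) : Matrix n n ℂ) * M - M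
      = (((hol U z (plaqWord μ κ) : (Matrix n n ℂ)ˣ) : Matrix n n ℂ) - 1) * M by noncomm_ring]
  have hp := norm_plaq_sub_one_le hs ha0 z μ κ
  have hn := norm_nonneg (((hol U z (plaqWord μ κ) : (Matrix n n ℂ)ˣ) : Matrix n n ℂ) - 1)
  exact (norm_mul_le _ _).trans (by nlinarith)

/-- Commutation of a bond with the three-sided transporter `Q = U(z,κ)U(z+e_κ,ν)U(z+e_ν,κ)⁻¹`:
`U(z,μ)·Q(z+e_μ) = p₁p₂p₃ · Q(z)·U(z+e_ν,μ)` with three conjugated plaquette holonomies `p₁ = U(∂p_{μκ}(z))`,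
`p₂ = Ad_{U(z,κ)}U(∂p_{μν}(z+e_κ))`, `p₃ = Ad_{Q(z)}U(∂p_{κμ}(z+e_ν))`. [folklore] -/
theorem bond_comm_threeSides (U : B7Prop1Explicit.Site d → Fin d → (Matrix n n ℂ)ˣ) (z : B7Prop1Explicit.Site d)
    (μ κ ν : Fin d) :
    U z μ * threeSides U (z + e μ) κ ν
      = hol U z (plaqWord μ κ) * (U z κ * hol U (z + e κ) (plaqWord μ ν) * (U z κ)⁻¹)
        * (threeSides U z κ ν * hol U (z + e ν) (plaqWord κ μ) * (threeSides U z κ ν)⁻¹)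
        * (threeSides U z κ ν * U (z + e ν) μ) := by
  have e1 : z + e μ + e κ = z + e κ + e μ := add_right_comm _ _ _
  have e2 : z + e μ + e ν = z + e ν + e μ := add_right_comm _ _ _
  have e3 : z + e ν + e κ = z + e κ + e ν := add_right_comm _ _ _
  simp only [threeSides, hol_plaqWord_eq, e1, e2, e3]
  group

/-- Telescoping over three near-identity contractions acting on a contraction:
`‖p₁p₂p₃M − M‖ ≤ ‖p₁ − 1‖ + ‖p₂ − 1‖ + ‖p₃ − 1‖` for `‖p₂‖, ‖p₃‖, ‖M‖ ≤ 1`. [folklore] -/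
theorem norm_prod3_mul_sub_le {p₁ p₂ p₃ M : Matrix n n ℂ} (n2 : ‖p₂‖ ≤ 1) (n3 : ‖p₃‖ ≤ 1) (nM : ‖M‖ ≤ 1) :
    ‖p₁ * p₂ * p₃ * M - M‖ ≤ ‖p₁ - 1‖ + ‖p₂ - 1‖ + ‖p₃ - 1‖ := by
  rw [show p₁ * p₂ * p₃ * M - M = (p₁ - 1) * (p₂ * p₃ * M) + (p₂ - 1) * (p₃ * M) + (p₃ - 1) * M by noncomm_ring]
  have n3M : ‖p₃ * M‖ ≤ 1 := (norm_mul_le _ _).trans (by nlinarith [norm_nonneg p₃, norm_nonneg M])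
  have n23M : ‖p₂ * p₃ * M‖ ≤ 1 := by
    rw [mul_assoc]; exact (norm_mul_le _ _).trans (by nlinarith [norm_nonneg p₂, norm_nonneg (p₃ * M)])
  calc _ ≤ ‖(p₁ - 1) * (p₂ * p₃ * M)‖ + ‖(p₂ - 1) * (p₃ * M)‖ + ‖(p₃ - 1) * M‖ :=
        (norm_add_le _ _).trans (add_le_add (norm_add_le _ _) le_rfl)
    _ ≤ ‖p₁ - 1‖ * ‖p₂ * p₃ * M‖ + ‖p₂ - 1‖ * ‖p₃ * M‖ + ‖p₃ - 1‖ * ‖M‖ :=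
        add_le_add (add_le_add (norm_mul_le _ _) (norm_mul_le _ _)) (norm_mul_le _ _)
    _ ≤ ‖p₁ - 1‖ * 1 + ‖p₂ - 1‖ * 1 + ‖p₃ - 1‖ * 1 := by gcongr
    _ = _ := by ring

/-- Its norm defect: `‖U(z,μ)Q(z+e_μ) − Q(z)U(z+e_ν,μ)‖ ≤ 3a`. [folklore] -/
theorem norm_bond_comm_threeSides [Nonempty n] (hU : IsUnitaryCfg U) (hs : SmallField U a) (ha0 : 0 ≤ a)
    (z : B7Prop1Explicit.Site d) (μ κ ν : Fin d) :
    ‖((U z μ * threeSides U (z + e μ) κ ν : (Matrix n n ℂ)ˣ) : Matrix n n ℂ)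
        - ((threeSides U z κ ν * U (z + e ν) μ : (Matrix n n ℂ)ˣ) : Matrix n n ℂ)‖ ≤ 3 * a := by
  have hQ : ∀ w : B7Prop1Explicit.Site d, threeSides U w κ ν ∈ unitaryUnits (Matrix n n ℂ) := fun w =>
    (unitaryUnits _).mul_mem ((unitaryUnits _).mul_mem (hU _ _) (hU _ _)) ((unitaryUnits _).inv_mem (hU _ _))
  rw [bond_comm_threeSides U z μ κ ν]
  simp only [Units.val_mul]
  have nM : ‖((threeSides U z κ ν : (Matrix n n ℂ)ˣ) : Matrix n n ℂ) * (U (z + e ν) μ : Matrix n n ℂ)‖ ≤ 1 := by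
    rw [← Units.val_mul]; exact (mem_U1_of_unitary ((unitaryUnits _).mul_mem (hQ z) (hU _ _))).1
  have hp2u : U z κ * hol U (z + e κ) (plaqWord μ ν) * (U z κ)⁻¹ ∈ unitaryUnits (Matrix n n ℂ) :=
    (unitaryUnits _).mul_mem ((unitaryUnits _).mul_mem (hU _ _) (hol_mem_of hU _ _)) ((unitaryUnits _).inv_mem (hU _ _))
  have hp3u : threeSides U z κ ν * hol U (z + e ν) (plaqWord κ μ) * (threeSides U z κ ν)⁻¹
      ∈ unitaryUnits (Matrix n n ℂ) :=
    (unitaryUnits _).mul_mem ((unitaryUnits _).mul_mem (hQ z) (hol_mem_of hU _ _)) ((unitaryUnits _).inv_mem (hQ z))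
  have n2 : ‖((U z κ : (Matrix n n ℂ)ˣ) : Matrix n n ℂ) * ((hol U (z + e κ) (plaqWord μ ν) : (Matrix n n ℂ)ˣ) : Matrix n n ℂ)
      * (((U z κ)⁻¹ : (Matrix n n ℂ)ˣ) : Matrix n n ℂ)‖ ≤ 1 := by
    rw [← Units.val_mul, ← Units.val_mul]; exact (mem_U1_of_unitary hp2u).1
  have n3 : ‖((threeSides U z κ ν : (Matrix n n ℂ)ˣ) : Matrix n n ℂ) * ((hol U (z + e ν) (plaqWord κ μ) : (Matrix n n ℂ)ˣ) : Matrix n n ℂ)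
      * (((threeSides U z κ ν)⁻¹ : (Matrix n n ℂ)ˣ) : Matrix n n ℂ)‖ ≤ 1 := by
    rw [← Units.val_mul, ← Units.val_mul]; exact (mem_U1_of_unitary hp3u).1
  have b1 := norm_plaq_sub_one_le hs ha0 z μ κ; have b2 : ‖((U z κ : (Matrix n n ℂ)ˣ) : Matrix n n ℂ) * ((hol U (z + e κ) (plaqWord μ ν) : (Matrix n n ℂ)ˣ) : Matrix n n ℂ)
      * (((U z κ)⁻¹ : (Matrix n n ℂ)ˣ) : Matrix n n ℂ) - 1‖ ≤ a := by
    rw [show ((U z κ : (Matrix n n ℂ)ˣ) : Matrix n n ℂ) * ((hol U (z + e κ) (plaqWord μ ν) : (Matrix n n ℂ)ˣ) : Matrix n n ℂ)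
        * (((U z κ)⁻¹ : (Matrix n n ℂ)ˣ) : Matrix n n ℂ) - 1
        = Ad (U z κ) (((hol U (z + e κ) (plaqWord μ ν) : (Matrix n n ℂ)ˣ) : Matrix n n ℂ) - 1) by rw [Ad_sub, Ad_apply_one, Ad],
      norm_Ad_of_unitary (hU z κ)]
    exact norm_plaq_sub_one_le hs ha0 _ _ _
  have b3 : ‖((threeSides U z κ ν : (Matrix n n ℂ)ˣ) : Matrix n n ℂ) * ((hol U (z + e ν) (plaqWord κ μ) : (Matrix n n ℂ)ˣ) : Matrix n n ℂ)
      * (((threeSides U z κ ν)⁻¹ : (Matrix n n ℂ)ˣ) : Matrix n n ℂ) - 1‖ ≤ a := by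
    rw [show ((threeSides U z κ ν : (Matrix n n ℂ)ˣ) : Matrix n n ℂ) * ((hol U (z + e ν) (plaqWord κ μ) : (Matrix n n ℂ)ˣ) : Matrix n n ℂ)
        * (((threeSides U z κ ν)⁻¹ : (Matrix n n ℂ)ˣ) : Matrix n n ℂ) - 1
        = Ad (threeSides U z κ ν) (((hol U (z + e ν) (plaqWord κ μ) : (Matrix n n ℂ)ˣ) : Matrix n n ℂ) - 1) by
          rw [Ad_sub, Ad_apply_one, Ad],
      norm_Ad_of_unitary (hQ z)]
    exact norm_plaq_sub_one_le hs ha0 _ _ _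
  have h := norm_prod3_mul_sub_le (p₁ := ((hol U z (plaqWord μ κ) : (Matrix n n ℂ)ˣ) : Matrix n n ℂ)) n2 n3 nM
  simp only [mul_assoc] at h b2 b3 ⊢
  linarith [b1, b2, b3, h]

/-- Norm defect of a bond against the plaquette holonomies at its two ends: `‖U(z,μ)U(∂p)(z+e_μ) − U(∂p)(z)U(z,μ)‖ ≤ 2a`.
[folklore] -/
theorem norm_bond_comm_plaq [Nonempty n] (hU : IsUnitaryCfg U) (hs : SmallField U a) (ha0 : 0 ≤ a)
    (z : B7Prop1Explicit.Site d) (μ κ ν : Fin d) :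
    ‖((U z μ * hol U (z + e μ) (plaqWord κ ν) : (Matrix n n ℂ)ˣ) : Matrix n n ℂ)
        - ((hol U z (plaqWord κ ν) * U z μ : (Matrix n n ℂ)ˣ) : Matrix n n ℂ)‖ ≤ 2 * a := by
  simp only [Units.val_mul]
  set u : Matrix n n ℂ := ((U z μ : (Matrix n n ℂ)ˣ) : Matrix n n ℂ)
  set P' : Matrix n n ℂ := ((hol U (z + e μ) (plaqWord κ ν) : (Matrix n n ℂ)ˣ) : Matrix n n ℂ)
  set P : Matrix n n ℂ := ((hol U z (plaqWord κ ν) : (Matrix n n ℂ)ˣ) : Matrix n n ℂ)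
  have nu : ‖u‖ ≤ 1 := (mem_U1_of_unitary (hU z μ)).1
  rw [show u * P' - P * u = u * (P' - 1) + (1 - P) * u by noncomm_ring]
  calc _ ≤ ‖u * (P' - 1)‖ + ‖(1 - P) * u‖ := norm_add_le _ _
    _ ≤ ‖u‖ * ‖P' - 1‖ + ‖1 - P‖ * ‖u‖ := add_le_add (norm_mul_le _ _) (norm_mul_le _ _)
    _ ≤ 1 * a + a * 1 := by
        gcongr
        · exact norm_plaq_sub_one_le hs ha0 _ _ _
        · rw [norm_sub_rev]; exact norm_plaq_sub_one_le hs ha0 _ _ _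
    _ = 2 * a := by ring

end Commute

/-! ## §2 The covariant gradient of the shift `D` -/

section ShiftGrad

variable {L : ℕ} {U : B7Prop1Explicit.Site d → Fin d → (Matrix n n ℂ)ˣ} {a g x₀ : ℝ}

/-- **THE COVARIANT GRADIENT OF THE SHIFT**: `‖Ad_{U(z,μ)} D(z+e_μ) − D(z)‖ ≤ 4·c_X + 12·a·x₀` where
`c_X = ((L−1)/(2L))·(d−1)·g` bounds the covariant gradient of `X₀` (file 5), `x₀ ≥ ‖X₀‖`, `a` the small-field radius.
[folklore] -/
theorem norm_covGrad_fluxShift_le [Nonempty n] (hL : 1 ≤ L) (hU : IsUnitaryCfg U) (hs : SmallField U a)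
    (ha0 : 0 ≤ a) (ha : a ≤ 1 / 4)
    (hg : ∀ (z : B7Prop1Explicit.Site d) (μ : Fin d) (π : T4AveragingDeficitWall.Plane d),
      ‖covGrad U (flux U) z μ π‖ ≤ g)
    (hX : ∀ z κ, ‖X0 L U z κ‖ ≤ x₀) (z : B7Prop1Explicit.Site d) (μ κ ν : Fin d) :
    ‖Ad (U z μ) (fluxShift L U (z + e μ) κ ν) - fluxShift L U z κ ν‖
      ≤ 4 * (precompCoeff L * (((d : ℝ) - 1) * g)) + 12 * a * x₀ := by
  set cX : ℝ := precompCoeff L * (((d : ℝ) - 1) * g) with hcX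
  have hQ : ∀ w : B7Prop1Explicit.Site d, threeSides U w κ ν ∈ unitaryUnits (Matrix n n ℂ) := fun w =>
    (unitaryUnits _).mul_mem ((unitaryUnits _).mul_mem (hU _ _) (hU _ _)) ((unitaryUnits _).inv_mem (hU _ _))
  have hG : ∀ (w : B7Prop1Explicit.Site d) (μ' κ' : Fin d), ‖covGradX0 L U w μ' κ'‖ ≤ cX :=
    fun w μ' κ' => norm_covGradX0_le hL hs ha hg w μ' κ'
  -- the four terms
  have T1 : ‖-(Ad (U z μ) (X0 L U (z + e μ) κ)) - -X0 L U z κ‖ ≤ cX := by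
    rw [show -(Ad (U z μ) (X0 L U (z + e μ) κ)) - -X0 L U z κ = -covGradX0 L U z μ κ by rw [covGradX0]; abel,
      norm_neg]
    exact hG z μ κ
  have T2 : ‖Ad (U z μ) (Ad (U (z + e μ) κ) (X0 L U (z + e μ + e κ) ν)) - Ad (U z κ) (X0 L U (z + e κ) ν)‖
      ≤ 2 * a * x₀ + cX := by
    rw [show z + e μ + e κ = z + e κ + e μ from add_right_comm _ _ _]
    refine (norm_transport_le (hU z μ) (hU (z + e κ) μ) (hU z κ) (hU (z + e μ) κ) _ _).trans ?_
    refine add_le_add ?_ (hG (z + e κ) μ ν)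
    calc _ ≤ 2 * a * ‖X0 L U (z + e κ + e μ) ν‖ := by
          gcongr; exact norm_bond_comm_two hU hs ha0 z μ κ
      _ ≤ 2 * a * x₀ := by gcongr; exact hX _ _
  have T3 : ‖Ad (U z μ) (Ad (threeSides U (z + e μ) κ ν) (X0 L U (z + e μ + e ν) κ))
      - Ad (threeSides U z κ ν) (X0 L U (z + e ν) κ)‖ ≤ 2 * (3 * a) * x₀ + cX := by
    rw [show z + e μ + e ν = z + e ν + e μ from add_right_comm _ _ _]
    refine (norm_transport_le (hU z μ) (hU (z + e ν) μ) (hQ z) (hQ (z + e μ)) _ _).trans ?_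
    refine add_le_add ?_ (hG (z + e ν) μ κ)
    calc _ ≤ 2 * (3 * a) * ‖X0 L U (z + e ν + e μ) κ‖ := by
          gcongr; exact norm_bond_comm_threeSides hU hs ha0 z μ κ ν
      _ ≤ 2 * (3 * a) * x₀ := by gcongr; exact hX _ _
  have T4 : ‖Ad (U z μ) (Ad (hol U (z + e μ) (plaqWord κ ν)) (X0 L U (z + e μ) ν))
      - Ad (hol U z (plaqWord κ ν)) (X0 L U z ν)‖ ≤ 2 * (2 * a) * x₀ + cX := by
    refine (norm_transport_le (hU z μ) (hU z μ) (hol_mem_of hU _ _) (hol_mem_of hU _ _) _ _).trans ?_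
    refine add_le_add ?_ (hG z μ ν)
    calc _ ≤ 2 * (2 * a) * ‖X0 L U (z + e μ) ν‖ := by
          gcongr; exact norm_bond_comm_plaq hU hs ha0 z μ κ ν
      _ ≤ 2 * (2 * a) * x₀ := by gcongr; exact hX _ _
  -- assemble
  have hsplit : Ad (U z μ) (fluxShift L U (z + e μ) κ ν) - fluxShift L U z κ ν
      = (-(Ad (U z μ) (X0 L U (z + e μ) κ)) - -X0 L U z κ)
        - (Ad (U z μ) (Ad (U (z + e μ) κ) (X0 L U (z + e μ + e κ) ν)) - Ad (U z κ) (X0 L U (z + e κ) ν))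
        + (Ad (U z μ) (Ad (threeSides U (z + e μ) κ ν) (X0 L U (z + e μ + e ν) κ))
            - Ad (threeSides U z κ ν) (X0 L U (z + e ν) κ))
        + (Ad (U z μ) (Ad (hol U (z + e μ) (plaqWord κ ν)) (X0 L U (z + e μ) ν))
            - Ad (hol U z (plaqWord κ ν)) (X0 L U z ν)) := by
    simp only [fluxShift, Ad_add, Ad_sub, Ad_neg]; abel
  rw [hsplit]
  calc _ ≤ ‖-(Ad (U z μ) (X0 L U (z + e μ) κ)) - -X0 L U z κ‖
        + ‖Ad (U z μ) (Ad (U (z + e μ) κ) (X0 L U (z + e μ + e κ) ν)) - Ad (U z κ) (X0 L U (z + e κ) ν)‖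
        + ‖Ad (U z μ) (Ad (threeSides U (z + e μ) κ ν) (X0 L U (z + e μ + e ν) κ))
            - Ad (threeSides U z κ ν) (X0 L U (z + e ν) κ)‖
        + ‖Ad (U z μ) (Ad (hol U (z + e μ) (plaqWord κ ν)) (X0 L U (z + e μ) ν))
            - Ad (hol U z (plaqWord κ ν)) (X0 L U z ν)‖ := by
        refine (norm_add_le _ _).trans (add_le_add ((norm_add_le _ _).trans (add_le_add (norm_sub_le _ _) le_rfl)) le_rfl)
    _ ≤ cX + (2 * a * x₀ + cX) + (2 * (3 * a) * x₀ + cX) + (2 * (2 * a) * x₀ + cX) :=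
        add_le_add (add_le_add (add_le_add T1 T2) T3) T4
    _ = 4 * cX + 12 * a * x₀ := by ring

end ShiftGrad

/-! ## §3 The covariant flux gradient of `T = exp(−X₀)·U` -/

section Main

variable {L : ℕ} {U : B7Prop1Explicit.Site d → Fin d → (Matrix n n ℂ)ˣ} {a g : ℝ}

/-- The `a²`-coefficient of the gradient transport: `60(d−1) + 312(d−1)² + 8(d−1)(8d−7)`. [folklore] -/
def gradRem (d : ℕ) : ℝ := 60 * ((d : ℝ) - 1) + 312 * ((d : ℝ) - 1) ^ 2 + 8 * ((d : ℝ) - 1) * (8 * (d : ℝ) - 7)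

/-- **THE COVARIANT FLUX GRADIENT OF THE PRE-COMPENSATED DATUM**: for `U` unitary in the small-field class of radius
`a` with `(d−1)a ≤ 1/32`, `(8d−7)a ≤ 1/4`, and covariant flux gradients `≤ g`, the datum `T = exp(−X₀)·U` has
`‖∇_T log T(∂p)‖ ≤ (2d − 1)·g + gradRem(d)·a²` at every bond and plane — first order: the coarse gradient plus four
transported covariant gradients of `X₀` (each `≤ ((L−1)/(2L))(d−1)g ≤ (d−1)g/2`); second order: commutators and the
flux remainder. [folklore] -/
theorem norm_covGrad_precomp_le [Nonempty n] (hL : 1 ≤ L) (hU : IsUnitaryCfg U) (hs : SmallField U a) (ha0 : 0 ≤ a)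
    (hg : ∀ (z : B7Prop1Explicit.Site d) (μ : Fin d) (π : T4AveragingDeficitWall.Plane d),
      ‖covGrad U (flux U) z μ π‖ ≤ g)
    (hda : ((d : ℝ) - 1) * a ≤ 1 / 32) (hdT : (8 * (d : ℝ) - 7) * a ≤ 1 / 4)
    (z : B7Prop1Explicit.Site d) (μ : Fin d) (π : T4AveragingDeficitWall.Plane d) :
    ‖covGrad (precomp L U) (flux (precomp L U)) z μ π‖ ≤ (2 * (d : ℝ) - 1) * g + gradRem d * a ^ 2 := by
  obtain ⟨⟨κ, ν⟩, hκν⟩ := π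
  have hd1 : (1 : ℝ) ≤ d := by exact_mod_cast (show 1 ≤ d from κ.pos)
  set lam : ℝ := (d : ℝ) - 1 with hlam
  have hlam0 : 0 ≤ lam := by linarith
  set x₀ : ℝ := lam * a with hx0def
  have hx00 : 0 ≤ x₀ := mul_nonneg hlam0 ha0
  have ha4 : a ≤ 1 / 4 := by nlinarith
  have hx032 : x₀ ≤ 1 / 32 := hda
  have hX : ∀ w κ', ‖X0 L U w κ'‖ ≤ x₀ := fun w κ' => norm_X0_le hL hs (by linarith) w κ'
  have hg0 : 0 ≤ g := (norm_nonneg _).trans (hg z μ ⟨(κ, ν), hκν⟩)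
  -- the datum and its flux
  set T := precomp L U
  set aT : ℝ := (8 * (d : ℝ) - 7) * a with haT
  have hTs : SmallField T aT := smallField_precomp hL hU hs ha4 (by linarith)
  have hFT : ∀ w, ‖flux T (w, ⟨(κ, ν), hκν⟩)‖ ≤ 2 * aT := fun w =>
    norm_flux_le_of_smallField hTs (by linarith) (w, ⟨(κ, ν), hκν⟩)
  -- the remainder of the first-order flux expansion
  set R : B7Prop1Explicit.Site d → Matrix n n ℂ :=
    fun w => flux T (w, ⟨(κ, ν), hκν⟩) - flux U (w, ⟨(κ, ν), hκν⟩) - fluxShift L U w κ ν with hRdef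
  have hR : ∀ w, ‖R w‖ ≤ 156 * x₀ ^ 2 + 24 * x₀ * a := fun w =>
    norm_flux_precomp_sub_le hU hs ha4 hX hx032 hκν w
  have hD := norm_covGrad_fluxShift_le hL hU hs ha0 ha4 hg hX z μ κ ν
  -- the conjugation by exp(−X₀(z,μ))
  have he : expUnit (-X0 L U z μ) ∈ unitaryUnits (Matrix n n ℂ) := expUnit_neg_X0_mem_unitary L hU hs ha4 z μ
  have heε : ‖((expUnit (-X0 L U z μ) : (Matrix n n ℂ)ˣ) : Matrix n n ℂ) - 1‖ ≤ 2 * x₀ := by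
    have h1 := (norm_exp_sub_one_le_of_norm_le (show ‖-X0 L U z μ‖ ≤ x₀ by rw [norm_neg]; exact hX _ _)).1
    have h := Real.abs_exp_sub_one_le (x := x₀) (by rw [abs_of_nonneg hx00]; linarith)
    rw [abs_of_nonneg hx00] at h
    rw [val_expUnit]; exact h1.trans ((le_abs_self _).trans h)
  set Y : Matrix n n ℂ := Ad (U z μ) (flux T (z + e μ, ⟨(κ, ν), hκν⟩)) with hYdef
  have hYn : ‖Y‖ ≤ 2 * aT := by rw [hYdef, norm_Ad_of_unitary (hU z μ)]; exact hFT _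
  have hAdY : ‖Ad (expUnit (-X0 L U z μ)) Y - Y‖ ≤ 2 * (2 * x₀) * (2 * aT) :=
    (norm_Ad_sub_le he Y).trans (by gcongr)
  -- decomposition
  have hcov : covGrad T (flux T) z μ ⟨(κ, ν), hκν⟩ = Ad (expUnit (-X0 L U z μ)) Y - flux T (z, ⟨(κ, ν), hκν⟩) := by
    rw [covGrad, hYdef, ← Ad_mul]; rfl
  have hY : Y = Ad (U z μ) (flux U (z + e μ, ⟨(κ, ν), hκν⟩)) + Ad (U z μ) (fluxShift L U (z + e μ) κ ν)
      + Ad (U z μ) (R (z + e μ)) := by rw [hYdef, ← Ad_add, ← Ad_add]; congr 1; simp only [hRdef]; abel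
  have hF : flux T (z, ⟨(κ, ν), hκν⟩) = flux U (z, ⟨(κ, ν), hκν⟩) + fluxShift L U z κ ν + R z := by
    simp only [hRdef]; abel
  have hsplit : Ad (expUnit (-X0 L U z μ)) Y - flux T (z, ⟨(κ, ν), hκν⟩)
      = (Ad (expUnit (-X0 L U z μ)) Y - Y) + covGrad U (flux U) z μ ⟨(κ, ν), hκν⟩
        + (Ad (U z μ) (fluxShift L U (z + e μ) κ ν) - fluxShift L U z κ ν) + (Ad (U z μ) (R (z + e μ)) - R z) := by
    rw [hF, covGrad, hY]; abel
  rw [hcov, hsplit]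
  have hRR : ‖Ad (U z μ) (R (z + e μ)) - R z‖ ≤ 2 * (156 * x₀ ^ 2 + 24 * x₀ * a) := by
    refine (norm_sub_le _ _).trans ?_
    rw [norm_Ad_of_unitary (hU z μ)]
    linarith [hR (z + e μ), hR z]
  have hpc : precompCoeff L * (lam * g) ≤ (1 / 2) * (lam * g) :=
    mul_le_mul_of_nonneg_right (precompCoeff_le_half hL) (mul_nonneg hlam0 hg0)
  calc _ ≤ ‖Ad (expUnit (-X0 L U z μ)) Y - Y‖ + ‖covGrad U (flux U) z μ ⟨(κ, ν), hκν⟩‖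
        + ‖Ad (U z μ) (fluxShift L U (z + e μ) κ ν) - fluxShift L U z κ ν‖ + ‖Ad (U z μ) (R (z + e μ)) - R z‖ :=
        (norm_add_le _ _).trans (add_le_add ((norm_add_le _ _).trans (add_le_add (norm_add_le _ _) le_rfl)) le_rfl)
    _ ≤ 2 * (2 * x₀) * (2 * aT) + g + (4 * (precompCoeff L * (lam * g)) + 12 * a * x₀)
        + 2 * (156 * x₀ ^ 2 + 24 * x₀ * a) := add_le_add (add_le_add (add_le_add hAdY (hg z μ _)) hD) hRR
    _ ≤ 2 * (2 * x₀) * (2 * aT) + g + (4 * ((1 / 2) * (lam * g)) + 12 * a * x₀)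
        + 2 * (156 * x₀ ^ 2 + 24 * x₀ * a) := by gcongr
    _ = (2 * (d : ℝ) - 1) * g + gradRem d * a ^ 2 := by
        simp only [hx0def, haT, hlam, gradRem]; ring

/-- `0 ≤ gradRem d` for `d ≥ 1`. [folklore] -/
theorem gradRem_nonneg {d : ℕ} (hd : 1 ≤ d) : 0 ≤ gradRem d := by
  have hd1 : (1 : ℝ) ≤ d := by exact_mod_cast hd
  have h1 : (0 : ℝ) ≤ (d : ℝ) - 1 := by linarith
  unfold gradRem; nlinarith

/-- **LEVEL FORM FOR THE SOCKET `ApproxRefine`**: at spacing `η = L^{−j}`, if `U` is unitary with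
`SmallField U (b·η²)` and covariant flux gradients `≤ c·η³` (the data of `RegularSup … b c j U`), and
`(d−1)b ≤ 1/32`, `(8d−7)b ≤ 1/4`, then `T = exp(−X₀)·U` is unitary with `SmallField T ((8d−7)b·η²)` and covariant flux
gradients `≤ ((2d−1)c + gradRem(d)·b²)·η³` — constants depending on `d, b, c` only (j-uniform). [folklore] -/
theorem precomp_level [Nonempty n] (hL : 1 ≤ L) (hU : IsUnitaryCfg U) {b c : ℝ} (hb0 : 0 ≤ b) (j : ℕ)
    (hs : SmallField U (b / ((L : ℝ) ^ j) ^ 2))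
    (hg : ∀ (z : B7Prop1Explicit.Site d) (μ : Fin d) (π : T4AveragingDeficitWall.Plane d),
      ‖covGrad U (flux U) z μ π‖ ≤ c / ((L : ℝ) ^ j) ^ 3)
    (hdb : ((d : ℝ) - 1) * b ≤ 1 / 32) (hdT : (8 * (d : ℝ) - 7) * b ≤ 1 / 4) :
    IsUnitaryCfg (precomp L U) ∧ SmallField (precomp L U) ((8 * (d : ℝ) - 7) * b / ((L : ℝ) ^ j) ^ 2) ∧
      ∀ (z : B7Prop1Explicit.Site d) (μ : Fin d) (π : T4AveragingDeficitWall.Plane d),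
        ‖covGrad (precomp L U) (flux (precomp L U)) z μ π‖
          ≤ ((2 * (d : ℝ) - 1) * c + gradRem d * b ^ 2) / ((L : ℝ) ^ j) ^ 3 := by
  have hLj : (1 : ℝ) ≤ (L : ℝ) ^ j := one_le_pow₀ (by exact_mod_cast hL)
  have hLj0 : (0 : ℝ) < (L : ℝ) ^ j := by positivity
  set a : ℝ := b / ((L : ℝ) ^ j) ^ 2 with hadef
  have ha0 : 0 ≤ a := by positivity
  have hab : a ≤ b := by
    rw [hadef, div_le_iff₀ (by positivity)]
    nlinarith [one_le_pow₀ (M₀ := ℝ) (a := ((L : ℝ) ^ j)) (n := 2) hLj]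
  rcases Nat.eq_zero_or_pos d with hd | hd
  · subst hd
    exact ⟨fun z κ => κ.elim0, fun z κ => κ.elim0, fun z κ => κ.elim0⟩
  have hd1 : (1 : ℝ) ≤ d := by exact_mod_cast hd
  have hda : ((d : ℝ) - 1) * a ≤ 1 / 32 := (mul_le_mul_of_nonneg_left hab (by linarith)).trans hdb
  have hdTa : (8 * (d : ℝ) - 7) * a ≤ 1 / 4 := (mul_le_mul_of_nonneg_left hab (by linarith)).trans hdT
  have ha4 : a ≤ 1 / 4 := by nlinarith
  refine ⟨isUnitaryCfg_precomp L hU hs ha4, ?_, fun z μ π => ?_⟩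
  · have := smallField_precomp hL hU hs ha4 (by linarith)
    rw [show (8 * (d : ℝ) - 7) * b / ((L : ℝ) ^ j) ^ 2 = (8 * (d : ℝ) - 7) * a by rw [hadef]; ring]
    exact this
  · have h := norm_covGrad_precomp_le hL hU hs ha0 hg hda hdTa z μ π
    have hR0 := gradRem_nonneg hd
    have hpow : ((L : ℝ) ^ j) ^ 3 ≤ (((L : ℝ) ^ j) ^ 2) ^ 2 := by
      rw [← pow_mul ((L : ℝ) ^ j) 2 2]; exact pow_le_pow_right₀ hLj (show 3 ≤ 2 * 2 by norm_num)
    have ha2 : a ^ 2 ≤ b ^ 2 / ((L : ℝ) ^ j) ^ 3 := by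
      rw [hadef, div_pow, div_le_div_iff₀ (by positivity) (by positivity)]; exact mul_le_mul_of_nonneg_left hpow (sq_nonneg b)
    calc _ ≤ (2 * (d : ℝ) - 1) * (c / ((L : ℝ) ^ j) ^ 3) + gradRem d * a ^ 2 := h
      _ ≤ (2 * (d : ℝ) - 1) * (c / ((L : ℝ) ^ j) ^ 3) + gradRem d * (b ^ 2 / ((L : ℝ) ^ j) ^ 3) := by
          gcongr
      _ = ((2 * (d : ℝ) - 1) * c + gradRem d * b ^ 2) / ((L : ℝ) ^ j) ^ 3 := by ring

end Main

end

end Summit.QuantumFields.BalabanUV.T4Continuum.SkeletonPrecompGrad
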